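import Summits.AtomisticToContinuum.BoseEinsteinCondensation.Theorems.ParticleTensorisation.Negative.PosdefDressingWells

/-!
# Crux `ParticleTensorisation` (stmt-AtomisticToContinuum-14367) — `Negative/`:
# spin-configuration cells of the dressed law and their shell integrals (file X1)

Toward `¬ stub_posdefDressing`: for a set `S` of particle labels, the configuration cell
`cfg S = ∏_k W_k^{±}` (`+` iff `k ∈ S`) has Lebesgue volume `(a³)^N`, lies in `Λ₃^N`, carries the
constant magnetisation `M = 2|S| - N`, and distinct `S` give disjoint cells. If the "energy" `E`
is within `1` of the Curie–Weiss energy `-(u/(N-1)) (M² - N)/2` on the wells (hypothesis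
`hEapprox`; discharged from the kernel file in the assembly), then the dressed Born density
`|A|² = w e^{-E}`, `A = √w e^{-E/2}`, is pinched on `cfg S` between `e^{∓1} · exp(b(M²-N²)/2 +
(u/(N-1))(M²-N)/2)`, whence two-sided bounds on the shell integrals `∫_{cfg S} |A|²`.
Rung style (defining hypotheses, no definitions).
-/

noncomputable section

namespace Summit.AtomisticToContinuum.BoseEinsteinCondensation.Theorems.PosdefDressingNeg

open MeasureTheory Function Finset Set
open scoped ENNReal
open Literature.MathematicalPhysics.QuantumManyBody.BoseGas

section Model

variable {N : ℕ} {a b u : ℝ}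
variable {qp qm : Fin N → Fin 3 → ℝ} {Wp Wm : Fin N → Set Space} {s : Space → ℝ}
  {χ : Fin N → Space → ℝ} {M : (Fin N → Space) → ℝ}
  {w E : (Fin N → Space) → ℝ} {A : (Fin N → Space) → ℂ}

/-! ### Configuration cells -/

/-- A point of the cell `cfg S` has every particle in its wells. [folklore] -/
theorem mem_wells_of_mem_cfg (S : Finset (Fin N)) {X : Fin N → Space}
    (hX : X ∈ Set.pi Set.univ (fun k => if k ∈ S then Wp k else Wm k)) (k : Fin N) :
    X k ∈ Wp k ∪ Wm k := by
  have h : X k ∈ (if k ∈ S then Wp k else Wm k) := hX k (Set.mem_univ k)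
  by_cases hk : k ∈ S
  · rw [if_pos hk] at h; exact Or.inl h
  · rw [if_neg hk] at h; exact Or.inr h

/-- The magnetisation is constant `2|S| - N` on the cell `cfg S`. [folklore] -/
theorem M_eq_of_mem_cfg (hs : ∀ x, s x = if x 0 < 5 / 4 then 1 else -1)
    (hqp : ∀ k, qp k = ![1, 1 + (k : ℝ) / N, 1]) (hqm : ∀ k, qm k = ![3 / 2, 1 + (k : ℝ) / N, 1])
    (hWp : ∀ k, Wp k = {x : Space | ∀ i, x i ∈ Ioo (qp k i) (qp k i + a)})
    (hWm : ∀ k, Wm k = {x : Space | ∀ i, x i ∈ Ioo (qm k i) (qm k i + a)}) (ha : a ≤ 1 / 4)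
    (hM : ∀ X, M X = ∑ k, s (X k)) (S : Finset (Fin N)) {X : Fin N → Space}
    (hX : X ∈ Set.pi Set.univ (fun k => if k ∈ S then Wp k else Wm k)) :
    M X = 2 * (S.card : ℝ) - N := by
  rw [hM]
  have hsk : ∀ k, s (X k) = if k ∈ S then (1 : ℝ) else -1 := by
    intro k
    have h : X k ∈ (if k ∈ S then Wp k else Wm k) := hX k (Set.mem_univ k)
    by_cases hk : k ∈ S
    · rw [if_pos hk] at h; rw [if_pos hk, s_of_mem_Wp hs hqp hWp ha h]
    · rw [if_neg hk] at h; rw [if_neg hk, s_of_mem_Wm hs hqm hWm h]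
  simp_rw [hsk]
  rw [Finset.sum_ite, Finset.sum_const, Finset.sum_const, nsmul_eq_mul, nsmul_eq_mul, mul_one,
    Finset.filter_mem_eq_inter, Finset.univ_inter]
  have hcard : ((Finset.univ.filter fun k : Fin N => k ∉ S).card : ℝ) = N - S.card := by
    have h1 : (Finset.univ.filter fun k : Fin N => k ∉ S) = Finset.univ \ S := by
      ext k; simp
    rw [h1, Finset.card_sdiff_of_subset (Finset.subset_univ S), Finset.card_univ, Fintype.card_fin,
      Nat.cast_sub (S.card_le_univ.trans_eq (Fintype.card_fin N))]
  rw [hcard]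
  ring

/-- The cell `cfg S` is measurable. [folklore] -/
theorem measurableSet_cfg (hWp : ∀ k, Wp k = {x : Space | ∀ i, x i ∈ Ioo (qp k i) (qp k i + a)})
    (hWm : ∀ k, Wm k = {x : Space | ∀ i, x i ∈ Ioo (qm k i) (qm k i + a)}) (S : Finset (Fin N)) :
    MeasurableSet (Set.pi Set.univ (fun k => if k ∈ S then Wp k else Wm k)) := by
  refine MeasurableSet.univ_pi fun k => ?_
  by_cases hk : k ∈ S
  · rw [if_pos hk, hWp]; exact measurableSet_cell _ _
  · rw [if_neg hk, hWm]; exact measurableSet_cell _ _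

/-- The cell `cfg S` has Lebesgue volume `(a³)^N`. [folklore] -/
theorem volume_cfg (hWp : ∀ k, Wp k = {x : Space | ∀ i, x i ∈ Ioo (qp k i) (qp k i + a)})
    (hWm : ∀ k, Wm k = {x : Space | ∀ i, x i ∈ Ioo (qm k i) (qm k i + a)}) (S : Finset (Fin N)) :
    volume (Set.pi Set.univ (fun k => if k ∈ S then Wp k else Wm k)) =
      (ENNReal.ofReal a ^ 3) ^ N := by
  rw [volume_pi_pi]
  have h : ∀ k : Fin N, volume (if k ∈ S then Wp k else Wm k) = ENNReal.ofReal a ^ 3 := by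
    intro k
    by_cases hk : k ∈ S
    · rw [if_pos hk, hWp]; exact volume_cell _ _
    · rw [if_neg hk, hWm]; exact volume_cell _ _
  simp_rw [h]
  rw [prod_const, card_univ, Fintype.card_fin]

/-- The cells lie in the box `Λ₃^N` (for `0 < a ≤ 1/4`). [folklore] -/
theorem cfg_subset_boxN (hqp : ∀ k, qp k = ![1, 1 + (k : ℝ) / N, 1])
    (hqm : ∀ k, qm k = ![3 / 2, 1 + (k : ℝ) / N, 1])
    (hWp : ∀ k, Wp k = {x : Space | ∀ i, x i ∈ Ioo (qp k i) (qp k i + a)})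
    (hWm : ∀ k, Wm k = {x : Space | ∀ i, x i ∈ Ioo (qm k i) (qm k i + a)}) (ha0 : 0 < a)
    (ha : a ≤ 1 / 4) (S : Finset (Fin N)) :
    Set.pi Set.univ (fun k => if k ∈ S then Wp k else Wm k) ⊆ boxN N 3 := by
  intro X hX k
  have h : X k ∈ (if k ∈ S then Wp k else Wm k) := hX k (Set.mem_univ k)
  have hk3 : ((k : ℕ) : ℝ) / N < 1 := by
    rcases Nat.eq_zero_or_pos N with hN | hN
    · exact absurd k.isLt (by omega)
    · rw [div_lt_one (by exact_mod_cast hN)]; exact_mod_cast k.isLt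
  have hk0 : 0 ≤ ((k : ℕ) : ℝ) / N := by positivity
  by_cases hk : k ∈ S
  · rw [if_pos hk, hWp] at h
    refine cell_subset_box (qp k) (fun i => ?_) (fun i => ?_) h <;>
      fin_cases i <;> simp [hqp] <;> linarith
  · rw [if_neg hk, hWm] at h
    refine cell_subset_box (qm k) (fun i => ?_) (fun i => ?_) h <;>
      fin_cases i <;> simp [hqm] <;> linarith

/-- Distinct label sets give disjoint cells. [folklore] -/
theorem pairwiseDisjoint_cfg (hqp : ∀ k, qp k = ![1, 1 + (k : ℝ) / N, 1])
    (hqm : ∀ k, qm k = ![3 / 2, 1 + (k : ℝ) / N, 1])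
    (hWp : ∀ k, Wp k = {x : Space | ∀ i, x i ∈ Ioo (qp k i) (qp k i + a)})
    (hWm : ∀ k, Wm k = {x : Space | ∀ i, x i ∈ Ioo (qm k i) (qm k i + a)}) (ha : a ≤ 1 / 4)
    (T : Finset (Finset (Fin N))) :
    (T : Set (Finset (Fin N))).PairwiseDisjoint
      (fun S => Set.pi Set.univ (fun k => if k ∈ S then Wp k else Wm k)) := by
  intro S _ S' _ hSS'
  rw [Function.onFun, Set.disjoint_left]
  intro X hX hX'
  obtain ⟨k, hk⟩ : ∃ k, ¬(k ∈ S ↔ k ∈ S') := by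
    by_contra h
    exact hSS' (Finset.ext fun k => not_not.mp (not_exists.mp h k))
  have h1 : X k ∈ (if k ∈ S then Wp k else Wm k) := hX k (Set.mem_univ k)
  have h2 : X k ∈ (if k ∈ S' then Wp k else Wm k) := hX' k (Set.mem_univ k)
  have hd := disjoint_Wp_Wm hqp hqm hWp hWm ha k k
  by_cases hkS : k ∈ S
  · have hkS' : k ∉ S' := fun h' => hk ⟨fun _ => h', fun _ => hkS⟩
    rw [if_pos hkS] at h1
    rw [if_neg hkS'] at h2
    exact Set.disjoint_left.mp hd h1 h2
  · have hkS' : k ∈ S' := by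
      by_contra h'
      exact hk ⟨fun h => absurd h hkS, fun h => absurd h h'⟩
    rw [if_neg hkS] at h1
    rw [if_pos hkS'] at h2
    exact Set.disjoint_left.mp hd h2 h1

/-! ### The dressed density on a cell -/

/-- `|A|² = w e^{-E}` as an `ℝ≥0∞`-valued density. [folklore] -/
theorem nnnorm_A_sq (hw0 : ∀ X, 0 ≤ w X)
    (hA : ∀ X, A X = ((Real.sqrt (w X) * Real.exp (-(E X) / 2) : ℝ) : ℂ)) (X : Fin N → Space) :
    ((‖A X‖₊ : ℝ≥0∞)) ^ 2 = ENNReal.ofReal (w X * Real.exp (-(E X))) := by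
  rw [hA, ← enorm_eq_nnnorm, ← ofReal_norm, ← ENNReal.ofReal_pow (norm_nonneg _), Complex.norm_real,
    Real.norm_eq_abs, abs_of_nonneg (mul_nonneg (Real.sqrt_nonneg _) (Real.exp_pos _).le), mul_pow,
    Real.sq_sqrt (hw0 X), ← Real.exp_nat_mul]
  congr 2
  push_cast
  ring

/-- **Two-sided pinching of `|A|²` on a cell.** On `cfg S` (magnetisation `M_S = 2|S| - N`),
`e^{Φ(M_S) - 1} ≤ |A|² ≤ e^{Φ(M_S) + 1}` with `Φ(M) = b(M² - N²)/2 + (u/(N-1))(M² - N)/2`,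
provided `E` is within `1` of `-(u/(N-1))(M² - N)/2` on the wells. [folklore] -/
theorem A_sq_pinch (hs : ∀ x, s x = if x 0 < 5 / 4 then 1 else -1)
    (hqp : ∀ k, qp k = ![1, 1 + (k : ℝ) / N, 1]) (hqm : ∀ k, qm k = ![3 / 2, 1 + (k : ℝ) / N, 1])
    (hWp : ∀ k, Wp k = {x : Space | ∀ i, x i ∈ Ioo (qp k i) (qp k i + a)})
    (hWm : ∀ k, Wm k = {x : Space | ∀ i, x i ∈ Ioo (qm k i) (qm k i + a)}) (ha : a ≤ 1 / 4)
    (hχ : ∀ k x, χ k x = (Wp k ∪ Wm k).indicator (fun _ => (1 : ℝ)) x)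
    (hM : ∀ X, M X = ∑ k, s (X k))
    (hw : ∀ X, w X = (∏ k, χ k (X k)) * Real.exp (b * ((M X) ^ 2 - (N : ℝ) ^ 2) / 2))
    (hA : ∀ X, A X = ((Real.sqrt (w X) * Real.exp (-(E X) / 2) : ℝ) : ℂ))
    (hEapprox : ∀ X, (∀ k, X k ∈ Wp k ∪ Wm k) →
      |E X + u / ((N : ℝ) - 1) * ((M X) ^ 2 - N) / 2| ≤ 1)
    (S : Finset (Fin N)) {X : Fin N → Space}
    (hX : X ∈ Set.pi Set.univ (fun k => if k ∈ S then Wp k else Wm k)) :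
    ENNReal.ofReal (Real.exp (b * ((2 * (S.card : ℝ) - N) ^ 2 - (N : ℝ) ^ 2) / 2 +
        u / ((N : ℝ) - 1) * ((2 * (S.card : ℝ) - N) ^ 2 - N) / 2 - 1)) ≤ ((‖A X‖₊ : ℝ≥0∞)) ^ 2 ∧
      ((‖A X‖₊ : ℝ≥0∞)) ^ 2 ≤ ENNReal.ofReal (Real.exp (b * ((2 * (S.card : ℝ) - N) ^ 2 -
        (N : ℝ) ^ 2) / 2 + u / ((N : ℝ) - 1) * ((2 * (S.card : ℝ) - N) ^ 2 - N) / 2 + 1)) := by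
  have hwells := mem_wells_of_mem_cfg S hX
  have hMS := M_eq_of_mem_cfg hs hqp hqm hWp hWm ha hM S hX
  have hw0 : ∀ X, 0 ≤ w X := fun X => by
    rw [hw]; exact mul_nonneg (prod_χ_mem hχ _ X).1 (Real.exp_pos _).le
  have hprod : ∏ k, χ k (X k) = 1 := prod_eq_one fun k _ => by
    rw [hχ, Set.indicator_of_mem (hwells k)]
  have hwX : w X = Real.exp (b * ((M X) ^ 2 - (N : ℝ) ^ 2) / 2) := by rw [hw, hprod, one_mul]
  have hE := hEapprox X hwells
  rw [abs_le] at hE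
  rw [nnnorm_A_sq hw0 hA X, hwX, ← Real.exp_add, hMS]
  rw [hMS] at hE
  constructor
  · exact ENNReal.ofReal_le_ofReal (Real.exp_le_exp.mpr (by linarith [hE.1, hE.2]))
  · exact ENNReal.ofReal_le_ofReal (Real.exp_le_exp.mpr (by linarith [hE.1, hE.2]))

/-- **Shell integral bounds.** `(a³)^N e^{Φ(M_S) - 1} ≤ ∫_{cfg S} |A|² ≤ (a³)^N e^{Φ(M_S) + 1}`.
[folklore] -/
theorem setLIntegral_cfg_bounds (hs : ∀ x, s x = if x 0 < 5 / 4 then 1 else -1)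
    (hqp : ∀ k, qp k = ![1, 1 + (k : ℝ) / N, 1]) (hqm : ∀ k, qm k = ![3 / 2, 1 + (k : ℝ) / N, 1])
    (hWp : ∀ k, Wp k = {x : Space | ∀ i, x i ∈ Ioo (qp k i) (qp k i + a)})
    (hWm : ∀ k, Wm k = {x : Space | ∀ i, x i ∈ Ioo (qm k i) (qm k i + a)}) (ha : a ≤ 1 / 4)
    (hχ : ∀ k x, χ k x = (Wp k ∪ Wm k).indicator (fun _ => (1 : ℝ)) x)
    (hM : ∀ X, M X = ∑ k, s (X k))
    (hw : ∀ X, w X = (∏ k, χ k (X k)) * Real.exp (b * ((M X) ^ 2 - (N : ℝ) ^ 2) / 2))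
    (hA : ∀ X, A X = ((Real.sqrt (w X) * Real.exp (-(E X) / 2) : ℝ) : ℂ))
    (hEapprox : ∀ X, (∀ k, X k ∈ Wp k ∪ Wm k) →
      |E X + u / ((N : ℝ) - 1) * ((M X) ^ 2 - N) / 2| ≤ 1)
    (S : Finset (Fin N)) :
    (ENNReal.ofReal a ^ 3) ^ N * ENNReal.ofReal (Real.exp (b * ((2 * (S.card : ℝ) - N) ^ 2 -
        (N : ℝ) ^ 2) / 2 + u / ((N : ℝ) - 1) * ((2 * (S.card : ℝ) - N) ^ 2 - N) / 2 - 1)) ≤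
      ∫⁻ X in Set.pi Set.univ (fun k => if k ∈ S then Wp k else Wm k), ((‖A X‖₊ : ℝ≥0∞)) ^ 2 ∧
    ∫⁻ X in Set.pi Set.univ (fun k => if k ∈ S then Wp k else Wm k), ((‖A X‖₊ : ℝ≥0∞)) ^ 2 ≤
      (ENNReal.ofReal a ^ 3) ^ N * ENNReal.ofReal (Real.exp (b * ((2 * (S.card : ℝ) - N) ^ 2 -
        (N : ℝ) ^ 2) / 2 + u / ((N : ℝ) - 1) * ((2 * (S.card : ℝ) - N) ^ 2 - N) / 2 + 1)) := by
  have hmeas := measurableSet_cfg hWp hWm S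
  have hvol := volume_cfg hWp hWm S
  constructor
  · calc (ENNReal.ofReal a ^ 3) ^ N * _
        = ∫⁻ _X in Set.pi Set.univ (fun k => if k ∈ S then Wp k else Wm k),
            ENNReal.ofReal (Real.exp (b * ((2 * (S.card : ℝ) - N) ^ 2 - (N : ℝ) ^ 2) / 2 +
              u / ((N : ℝ) - 1) * ((2 * (S.card : ℝ) - N) ^ 2 - N) / 2 - 1)) := by
          rw [setLIntegral_const, hvol, mul_comm]
      _ ≤ _ := setLIntegral_mono' hmeas fun X hX =>
          (A_sq_pinch hs hqp hqm hWp hWm ha hχ hM hw hA hEapprox S hX).1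
  · calc ∫⁻ X in Set.pi Set.univ (fun k => if k ∈ S then Wp k else Wm k), ((‖A X‖₊ : ℝ≥0∞)) ^ 2
        ≤ ∫⁻ _X in Set.pi Set.univ (fun k => if k ∈ S then Wp k else Wm k),
            ENNReal.ofReal (Real.exp (b * ((2 * (S.card : ℝ) - N) ^ 2 - (N : ℝ) ^ 2) / 2 +
              u / ((N : ℝ) - 1) * ((2 * (S.card : ℝ) - N) ^ 2 - N) / 2 + 1)) :=
          setLIntegral_mono' hmeas fun X hX =>
            (A_sq_pinch hs hqp hqm hWp hWm ha hχ hM hw hA hEapprox S hX).2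
      _ = _ := by rw [setLIntegral_const, hvol, mul_comm]

end Model

end Summit.AtomisticToContinuum.BoseEinsteinCondensation.Theorems.PosdefDressingNeg

end
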